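import Summits.ABC.ABC.Theses.IneffectiveSubspace
import Summits.ABC.ABC.Theorems.IneffectiveSubspaceDeepRegimeABCCensusStaircase
import Summits.ABC.ABC.Theorems.DeepRegimeABC.Negative.WithoutEps

/-!
# `DeepRegimeABC` (stmt-ABC-15121): certified census — the staircase is two-sided for EVERY `K`: `4·(p₀⋯p_{K-1})⁵ ≤ c_K³` and `c_K² ≤ p_{K-1}¹⁰·(p₀⋯p_{K-1})⁵`

Certificate file (line lead `prover-line-stmt-ABC-15121-c4-0`, 2026-08-17; human certificate objective) for
the crux `Summit.ABC.ABC.Theses.IneffectiveSubspace.DeepRegimeABC` (abc with exponent `1 + ε` on the deep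
tail `{ω₅(abc) ≥ K(ε)}`, `ω₅(n) := #{p : p⁵ ∣ n}`).  Write `c_K` for the least `c` of an abc triple with
`ω₅(abc) ≥ K` (certified exactly for `K ≤ 9`, bounded above by explicit members for `10 ≤ K ≤ 14`,
`…CensusStaircaseUpper.lean`).  `…CensusStaircase.lean` bounds every cell from BELOW without enumeration
(`four_mul_primorial_pow_le_cube`: `4·(p₀⋯p_{K-1})⁵ ≤ c³` for every member, every `K`).  This file is the
matching bound from ABOVE, again for every `K` and without enumeration:

* `exists_balanced_subset` — a finite set `S` of integers `≥ 2`, all `≤ M`, with product `P`, has a subset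
  `T` with `P < (∏ T)²  ≤ M²·P` (take `T` of least product among the subsets with `P < (∏ T)²`; removing any
  member of `T` leaves a product whose square is `≤ P`);
* `exists_member_of_primes` — for a finite set `S` of primes, all `≤ M`: with such a `T`, `X := ∏ (S \ T)`,
  `Z := ∏ T`, the triple **`(X⁵, Z⁵ − X⁵, Z⁵)` is an abc triple with `ω₅ ≥ #S` and `c² = Z¹⁰ ≤ M¹⁰·P⁵`**
  (`X < Z` from `XZ = P < Z²`; `gcd(X, Z) = 1` as the prime sets are disjoint);
* `exists_member_sq_le_all` — **for EVERY `K ≥ 1` the cell `{ω₅ ≥ K}` has a member with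
  `c² ≤ p_{K-1}¹⁰ · (p₀ p₁ ⋯ p_{K-1})⁵`** (`pᵢ = Nat.nth Nat.Prime i`), i.e. `c_K ≤ p_{K-1}⁵·(p₀⋯p_{K-1})^{5/2}`;
* `staircase_twoSided` — both sides in one statement (registered stub `censusStaircaseTwoSided`).

So `(5/3)·ϑ(p_{K-1}) + (log 4)/3 ≤ log c_K ≤ (5/2)·ϑ(p_{K-1}) + 5 log p_{K-1}` for all `K ≥ 1`
(`ϑ` = Chebyshev's function): the `K`-th deep cell begins at `log c_K ≍ K log K`, the exponent of the
primorial pinned between `5/3` and `5/2 + o(1)`; the measured values (`log c_K / log(p₀⋯p_{K-1}) = 2.27,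
2.36, 2.27` at `K = 7, 8, 9`, `≤ 2.27 … 2.33` for `10 ≤ K ≤ 14`) sit near the upper exponent.  Kernel-only
(no `decide` on data, no `native_decide`).  Nothing here bears on the truth of the crux (abc-hard); it closes
the "how fast do the deep cells recede" part of the requested census for all `K`, from both sides.
-/

-- `Summit.<Summit>.<Problem>` is the mandated summit-side namespace (CONVENTIONS §2); for the
-- single-conjunct summit `ABC` the two coincide, so the duplicate `ABC.ABC` is deliberate.
set_option linter.dupNamespace false

namespace Summit.ABC.ABC.Theorems.DeepRegimeABC

open Literature.NumberTheory.DiophantineGeometry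
open Summit.ABC.ABC.Theorems.DeepRegimeABC.Negative (mem_deep_of_pow_dvd)

/-! ## A balanced subset of a finite set of integers `≥ 2` -/

/-- **Balanced splitting.** A nonempty finite set `S` of integers `≥ 2`, all `≤ M`, with product `P`, has a
subset `T` with `P < (∏ T)²` and `(∏ T)² ≤ M²·P`. [folklore] -/
theorem exists_balanced_subset (S : Finset ℕ) (hS : S.Nonempty) {M : ℕ} (h2 : ∀ p ∈ S, 2 ≤ p)
    (hM : ∀ p ∈ S, p ≤ M) :
    ∃ T ⊆ S, ∏ p ∈ S, p < (∏ p ∈ T, p) ^ 2 ∧ (∏ p ∈ T, p) ^ 2 ≤ M ^ 2 * ∏ p ∈ S, p := by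
  classical
  have hpos : ∀ U ⊆ S, 0 < ∏ p ∈ U, p := fun U hU =>
    Finset.prod_pos fun p hp => lt_of_lt_of_le (by norm_num) (h2 p (hU hp))
  have hP2 : 2 ≤ ∏ p ∈ S, p := by
    obtain ⟨q, hq⟩ := hS
    calc 2 ≤ q := h2 q hq
      _ = ∏ p ∈ ({q} : Finset ℕ), p := by simp
      _ ≤ ∏ p ∈ S, p := Finset.prod_le_prod_of_subset_of_one_le' (Finset.singleton_subset_iff.mpr hq)
          (fun p hp _ => le_trans (by norm_num) (h2 p hp))
  -- the qualifying subsets, and one of least product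
  set F : Finset (Finset ℕ) := S.powerset.filter (fun T => ∏ p ∈ S, p < (∏ p ∈ T, p) ^ 2) with hF
  have hSF : S ∈ F := by
    rw [hF, Finset.mem_filter]
    exact ⟨Finset.mem_powerset_self S, by nlinarith⟩
  obtain ⟨T, hTF, hmin⟩ := F.exists_min_image (fun T => ∏ p ∈ T, p) ⟨S, hSF⟩
  rw [hF, Finset.mem_filter, Finset.mem_powerset] at hTF
  obtain ⟨hTS, hlt⟩ := hTF
  refine ⟨T, hTS, hlt, ?_⟩
  -- `T` is nonempty
  have hTne : T.Nonempty := by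
    rw [Finset.nonempty_iff_ne_empty]
    rintro rfl
    rw [Finset.prod_empty, one_pow] at hlt
    omega
  -- remove one member `q`: the rest no longer qualifies
  obtain ⟨q, hq⟩ := hTne
  have hqS : q ∈ S := hTS hq
  have hprod : ∏ p ∈ T, p = q * ∏ p ∈ T.erase q, p := (Finset.mul_prod_erase T (fun p => p) hq).symm
  have hrest : (∏ p ∈ T.erase q, p) ^ 2 ≤ ∏ p ∈ S, p := by
    by_contra hgt
    push Not at hgt
    have hmem : T.erase q ∈ F := by
      rw [hF, Finset.mem_filter, Finset.mem_powerset]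
      exact ⟨(Finset.erase_subset q T).trans hTS, hgt⟩
    have hle := hmin _ hmem
    rw [hprod] at hle
    have h0 := hpos (T.erase q) ((Finset.erase_subset q T).trans hTS)
    have hq2 := h2 q hqS
    nlinarith
  calc (∏ p ∈ T, p) ^ 2 = q ^ 2 * (∏ p ∈ T.erase q, p) ^ 2 := by rw [hprod]; ring
    _ ≤ M ^ 2 * ∏ p ∈ S, p := Nat.mul_le_mul (Nat.pow_le_pow_left (hM q hqS) 2) hrest

/-! ## A member of the cell `ω₅ ≥ #S` from a set of primes `S` -/

/-- **A small member of a deep cell from any finite set of primes.** If `S` is a nonempty finite set of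
primes, all `≤ M`, with product `P`, there is an abc triple `(X⁵, Z⁵ − X⁵, Z⁵)` — `Z` the product of a
balanced subset, `X = P/Z` — with `ω₅ ≥ #S` and `c² ≤ M¹⁰·P⁵`. [folklore] -/
theorem exists_member_of_primes (S : Finset ℕ) (hS : S.Nonempty) {M : ℕ} (hpr : ∀ p ∈ S, p.Prime)
    (hM : ∀ p ∈ S, p ≤ M) :
    ∃ a b c : ℕ, IsABCTriple a b c ∧
      S.card ≤ ((a * b * c).primeFactors.filter (fun p => 5 ≤ (a * b * c).factorization p)).card ∧
      c ^ 2 ≤ M ^ 10 * (∏ p ∈ S, p) ^ 5 := by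
  classical
  obtain ⟨T, hTS, hlt, hle⟩ := exists_balanced_subset S hS (fun p hp => (hpr p hp).two_le) hM
  set Z : ℕ := ∏ p ∈ T, p with hZ
  set X : ℕ := ∏ p ∈ S \ T, p with hX
  have hXZ : X * Z = ∏ p ∈ S, p := Finset.prod_sdiff hTS
  have hX0 : 0 < X := Finset.prod_pos fun p hp => (hpr p (Finset.sdiff_subset hp)).pos
  have hZ0 : 0 < Z := Finset.prod_pos fun p hp => (hpr p (hTS hp)).pos
  have hXltZ : X < Z := by
    by_contra hge
    push Not at hge
    have : Z ^ 2 ≤ X * Z := by nlinarith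
    omega
  have hX5Z5 : X ^ 5 < Z ^ 5 := Nat.pow_lt_pow_left hXltZ (by norm_num)
  -- coprimality of the two parts: disjoint sets of primes
  have hcopXZ : Nat.Coprime X Z := by
    rw [hX, hZ, Nat.coprime_prod_left_iff]
    intro p hp
    rw [Nat.coprime_prod_right_iff]
    intro q hq
    have hpq : p ≠ q := fun e => (Finset.mem_sdiff.mp hp).2 (e ▸ hq)
    exact (Nat.coprime_primes (hpr p (Finset.sdiff_subset hp)) (hpr q (hTS hq))).mpr hpq
  have hcop : Nat.Coprime (X ^ 5) (Z ^ 5 - X ^ 5) := by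
    rw [Nat.coprime_sub_self_right hX5Z5.le]
    exact Nat.Coprime.pow 5 5 hcopXZ
  have habc : IsABCTriple (X ^ 5) (Z ^ 5 - X ^ 5) (Z ^ 5) :=
    ⟨pow_pos hX0 5, Nat.sub_pos_of_lt hX5Z5, by omega, hcop⟩
  refine ⟨X ^ 5, Z ^ 5 - X ^ 5, Z ^ 5, habc, ?_, ?_⟩
  · -- every prime of `S` is deep: in `a` if it lies outside `T`, in `c` if inside
    have hn0 : X ^ 5 * (Z ^ 5 - X ^ 5) * Z ^ 5 ≠ 0 := by
      have := Nat.sub_pos_of_lt hX5Z5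
      positivity
    refine Finset.card_le_card fun p hp => ?_
    refine mem_deep_of_pow_dvd hn0 (hpr p hp) ?_
    by_cases hpT : p ∈ T
    · have h1 : p ∣ Z := Finset.dvd_prod_of_mem (fun p => p) hpT
      exact dvd_trans (pow_dvd_pow_of_dvd h1 5) (dvd_mul_left _ _)
    · have hpd : p ∈ S \ T := Finset.mem_sdiff.mpr ⟨hp, hpT⟩
      have h1 : p ∣ X := Finset.dvd_prod_of_mem (fun p => p) hpd
      exact dvd_trans (pow_dvd_pow_of_dvd h1 5) (dvd_trans (dvd_mul_right _ _) (dvd_mul_right _ _))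
  · -- `c² = Z¹⁰ = (Z²)⁵ ≤ (M²·P)⁵ = M¹⁰·P⁵`
    calc (Z ^ 5) ^ 2 = (Z ^ 2) ^ 5 := by ring
      _ ≤ (M ^ 2 * ∏ p ∈ S, p) ^ 5 := Nat.pow_le_pow_left hle 5
      _ = M ^ 10 * (∏ p ∈ S, p) ^ 5 := by ring

/-! ## The first `K` primes -/

/-- **For EVERY `K ≥ 1` the cell `{ω₅ ≥ K}` has a member with `c² ≤ p_{K-1}¹⁰ · (p₀ p₁ ⋯ p_{K-1})⁵`**, i.e.
`c_K ≤ p_{K-1}⁵ · (p₀⋯p_{K-1})^{5/2}` (`pᵢ = Nat.nth Nat.Prime i`). [folklore] -/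
theorem exists_member_sq_le_all {K : ℕ} (hK : 1 ≤ K) :
    ∃ a b c : ℕ, IsABCTriple a b c ∧
      K ≤ ((a * b * c).primeFactors.filter (fun p => 5 ≤ (a * b * c).factorization p)).card ∧
      c ^ 2 ≤ (Nat.nth Nat.Prime (K - 1)) ^ 10 * (∏ i ∈ Finset.range K, Nat.nth Nat.Prime i) ^ 5 := by
  classical
  have hinj : Function.Injective (Nat.nth Nat.Prime) := Nat.nth_injective Nat.infinite_setOf_prime
  set S : Finset ℕ := (Finset.range K).image (Nat.nth Nat.Prime) with hSdef
  have hcard : S.card = K := by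
    rw [hSdef, Finset.card_image_of_injective _ hinj, Finset.card_range]
  have hprodS : ∏ p ∈ S, p = ∏ i ∈ Finset.range K, Nat.nth Nat.Prime i := by
    rw [hSdef, Finset.prod_image (fun i _ j _ h => hinj h)]
  have hne : S.Nonempty := by
    rw [← Finset.card_pos, hcard]; exact hK
  have hpr : ∀ p ∈ S, p.Prime := by
    intro p hp
    rw [hSdef, Finset.mem_image] at hp
    obtain ⟨i, -, rfl⟩ := hp
    exact Nat.prime_nth_prime i
  have hM : ∀ p ∈ S, p ≤ Nat.nth Nat.Prime (K - 1) := by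
    intro p hp
    rw [hSdef, Finset.mem_image] at hp
    obtain ⟨i, hi, rfl⟩ := hp
    rw [Finset.mem_range] at hi
    exact Nat.nth_monotone Nat.infinite_setOf_prime (by omega)
  obtain ⟨a, b, c, habc, hdepth, hbound⟩ := exists_member_of_primes S hne hpr hM
  rw [hcard] at hdepth
  rw [hprodS] at hbound
  exact ⟨a, b, c, habc, hdepth, hbound⟩

/-- **The two-sided staircase, every `K ≥ 1`:** some member of the cell `{ω₅ ≥ K}` has
`c² ≤ p_{K-1}¹⁰·(p₀⋯p_{K-1})⁵`, every member has `4·(p₀⋯p_{K-1})⁵ ≤ c³`. [folklore] -/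
theorem staircase_twoSided {K : ℕ} (hK : 1 ≤ K) :
    (∃ a b c : ℕ, IsABCTriple a b c ∧
      K ≤ ((a * b * c).primeFactors.filter (fun p => 5 ≤ (a * b * c).factorization p)).card ∧
      c ^ 2 ≤ (Nat.nth Nat.Prime (K - 1)) ^ 10 * (∏ i ∈ Finset.range K, Nat.nth Nat.Prime i) ^ 5) ∧
    (∀ a b c : ℕ, IsABCTriple a b c →
      K ≤ ((a * b * c).primeFactors.filter (fun p => 5 ≤ (a * b * c).factorization p)).card →
      4 * (∏ i ∈ Finset.range K, Nat.nth Nat.Prime i) ^ 5 ≤ c ^ 3) :=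
  ⟨exists_member_sq_le_all hK, fun _ _ _ h hKd => four_mul_primorial_pow_le_cube h hKd⟩

/-! ## Registered certificate stub of the crux item (stmt-ABC-15121) -/

/-- **Registered certificate `censusStaircaseTwoSided`** (crux `DeepRegimeABC`, line SketchIdeator5R2, human
certificate objective): for every `K ≥ 1`, the cell `{ω₅ ≥ K}` has a member with
`c² ≤ p_{K-1}¹⁰·(p₀⋯p_{K-1})⁵` and all its members satisfy `4·(p₀⋯p_{K-1})⁵ ≤ c³` — the deep cells recede
like `log c_K ≍ ϑ(p_{K-1}) ≍ K log K`, the exponent of the primorial between `5/3` and `5/2 + o(1)`,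
no enumeration. [folklore] -/
theorem censusStaircaseTwoSided : ∀ K : ℕ, 1 ≤ K → (∃ a b c : ℕ, Literature.NumberTheory.DiophantineGeometry.IsABCTriple a b c ∧ K ≤ ((a * b * c).primeFactors.filter (fun p => 5 ≤ (a * b * c).factorization p)).card ∧ c ^ 2 ≤ (Nat.nth Nat.Prime (K - 1)) ^ 10 * (∏ i ∈ Finset.range K, Nat.nth Nat.Prime i) ^ 5) ∧ (∀ a b c : ℕ, Literature.NumberTheory.DiophantineGeometry.IsABCTriple a b c → K ≤ ((a * b * c).primeFactors.filter (fun p => 5 ≤ (a * b * c).factorization p)).card → 4 * (∏ i ∈ Finset.range K, Nat.nth Nat.Prime i) ^ 5 ≤ c ^ 3) :=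
  fun _ hK => staircase_twoSided hK

end Summit.ABC.ABC.Theorems.DeepRegimeABC
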